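import Summits.BirchSwinnertonDyer.BirchSwinnertonDyer.Theorems.ErratumRoadFiveNonSurjCornerKolyJSwapRow
import Summits.BirchSwinnertonDyer.BirchSwinnertonDyer.Theorems.ErratumRoadFiveNonSurjCornerKolyJWalkCebotarev
import Summits.BirchSwinnertonDyer.BirchSwinnertonDyer.Theorems.ClassRecordThreeShimuraKolyvaginMinusOneSquare
import HarnessLib

/-!
# The prime swap on the row objects with the ČEBOTAREV INPUT DISCHARGED: the (T4′)∕(T4″) corner (`E[p]` irreducible,
# `−1` in the image) and the `ρ̄`-onto frames (19109) — corollaries of `Koly.exists_deep_of_swapFamilies`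
# (cell `bsd-stepL`, seat `bsd-stepL-corner-p1` g8; `--supports stmt-BirchSwinnertonDyer-19947`)

WHAT. `…KolyJSwapRow.lean` instantiates the abstract prime swap (p505956) on `H¹(K, E[p^k])` with the walk's dictionary,
taking the Čebotarev supply `h61c` as a hypothesis in the common shape of the two kernel theorems
`Koly.exists_kolyvaginPrime_addOrderOf_localization_eq_shift[_of_irr_of_neg]` (tam3-p1 p494064 ∕ this seat p501512).
Here the three specialisations: `exists_deep_of_swapFamilies_of_irr_of_neg` (corner: `Irr`, `hneg`, Gross's disjointness
prime `q ∣ d_K`, `q ∤ N_E`, `q ≠ p`), `exists_deep_of_swapFamilies_of_irr_three` (the @3 corner: `−1` is automatic at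
`3`, shim3b's `exists_sq_smul_eq_neg_three_of_irr`) and `exists_deep_of_swapFamilies_of_surj` (`ρ̄` onto). Remaining NAMED inputs of
the swap supply after this file: `hPT` (shared with the walk), the level-`p` local Tate pairing package
(`pair`∕`hperf`∕`hrec`), the `κ̄` dictionary (`κb`∕`hκSel`∕`h44c`∕`hκ0`) — use with `k = 1`.
HONEST FRAMING: three theorems, no definition ∕ fact ∕ sorry; nothing discharged beyond Čebotarev; no stub closes; T7.
References (locators only): [cite: McCallumLMS1991, §3 Cor. 3.2, §5 Prop. 5.2] [cite: BurungaleEtAl2026, Prop. 2.2.1]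
[cite: Jetchev2008, Lemma 5.1, Rem. 6.2 (p. 821)].
-/

set_option autoImplicit false

noncomputable section

open scoped Classical NumberField

namespace Summit.BirchSwinnertonDyer.Rank1Residual.X11b.Three.Koly

open WeierstrassCurve IsDedekindDomain NumberField Literature.NumberTheory.EllipticCurves
  Literature.NumberTheory.EllipticCurves.ModularForms Literature.NumberTheory.EllipticCurves.Jetchev2008
  Literature.NumberTheory.GaloisRepresentations
  Literature.NumberTheory.GaloisRepresentations.DiscreteGaloisModule
  Summit.BirchSwinnertonDyer.Rank1Residual.JET Summit.BirchSwinnertonDyer.BirchSwinnertonDyer.Theorems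

/-- **The prime swap on the (T4′)∕(T4″) CORNER row objects** — `exists_deep_of_swapFamilies` with its Čebotarev input
DISCHARGED on the irreducible cell: `E[p]` irreducible, `−1 ∈ ρ̄_{E,p}(Γ_ℚ)`, `K` imaginary quadratic, `p` odd, and
Gross's disjointness prime `q ∣ d_K`, `q ∤ N_E`, `q ≠ p` (any prime factor of a Heegner `d_K`), via this seat's
`exists_kolyvaginPrime_addOrderOf_localization_eq_shift_of_irr_of_neg` (p501512). Remaining inputs: `hPT`, the pairing
package, the `κ̄` dictionary. [cite: McCallumLMS1991, §5 Prop. 5.2 (p. 304), §3 Cor. 3.2 (p. 299)]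
[cite: BurungaleEtAl2026, Prop. 2.2.1 (§2.2)] [cite: Jetchev2008, Lemma 5.1, Rem. 6.2 (p. 821)] -/
theorem exists_deep_of_swapFamilies_of_irr_of_neg
    (W : WeierstrassCurve ℚ) [W.IsElliptic] [W.IsGloballyMinimal] [NeZero (W.conductorNorm ℤ)]
    (K : Type) [Field K] [NumberField K] (p : ℕ) [Fact p.Prime]
    (Dt : ModularParametrizationData W (W.conductorNorm ℤ)) (β : ℤ) (ι : K →+* ℂ)
    (hK : IsImaginaryQuadratic K) (hp2 : p ≠ 2) (hirr : W.HasIrreducibleModPGaloisRep p)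
    (hneg : ∃ γ : Field.absoluteGaloisGroup ℚ, ∀ P : geomTorsion W p, γ • P = -P)
    {q : ℕ} (hq : q.Prime) (hqd : (q : ℤ) ∣ NumberField.discr K) (hqN : ¬ q ∣ W.conductorNorm ℤ) (hqp : q ≠ p)
    (τ : K ≃ₐ[ℚ] K) (hτ : τ ≠ 1) (k i₀ e₀ : ℕ) (hk : 1 ≤ k)
    (𝒯 : SelmerStructure ((W.baseChange K).torsionGaloisModule ((p ^ k : ℕ) : ℤ)))
    (D : ∀ s : {m : ℕ // Squarefree m ∧ ∀ q ∈ m.primeFactors,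
        Zhang2014.IsKolyvaginPrime (W.conductorNorm ℤ) W K p q ∧ i₀ ≤ Zhang2014.kolyvaginIndex W p q},
      KolyvaginHeegnerData Dt β ι s.1)
    (eb : ℕ → Bool) (heb : ∀ (m ℓ : ℕ), ℓ.Prime → ¬ ℓ ∣ m → eb (m * ℓ) = !eb m)
    -- global duality count at a relaxed prime, per sign (the walk's `hPT`)
    (hPT : ∀ (s : {m : ℕ // Squarefree m ∧ ∀ q ∈ m.primeFactors,
        Zhang2014.IsKolyvaginPrime (W.conductorNorm ℤ) W K p q ∧ i₀ ≤ Zhang2014.kolyvaginIndex W p q})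
      (ℓ : ℕ), Zhang2014.IsKolyvaginPrime (W.conductorNorm ℤ) W K p ℓ →
      i₀ ≤ Zhang2014.kolyvaginIndex W p ℓ → ¬ ℓ ∣ s.1 →
      ∀ v : HeightOneSpectrum (𝓞 K), (ℓ : 𝓞 K) ∈ v.asIdeal → ∀ b : Bool,
      Nat.card ((signPart W K τ ((p ^ k : ℕ) : ℤ) (if b then 1 else -1)
          ((selmerF W ((p ^ k : ℕ) : ℤ) 𝒯 (placesDividing K s.1)).relaxedAt {v}).selmerGroup).map
        (galoisCohomology.localization ((W.baseChange K).torsionGaloisModule ((p ^ k : ℕ) : ℤ))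
          (Sum.inr v) 1)) = p ^ k)
    -- the level-`p` local Tate pairing package
    {Z : Type} [AddCommGroup Z]
    (pair : ∀ v : HeightOneSpectrum (𝓞 K),
      galoisCohomology (((W.baseChange K).torsionGaloisModule ((p ^ k : ℕ) : ℤ)).toLocal (Sum.inr v)) 1 →+
      galoisCohomology (((W.baseChange K).torsionGaloisModule ((p ^ k : ℕ) : ℤ)).toLocal (Sum.inr v)) 1 →+ Z)
    (hperf : ∀ (ℓ : ℕ), Zhang2014.IsKolyvaginPrime (W.conductorNorm ℤ) W K p ℓ →
      i₀ ≤ Zhang2014.kolyvaginIndex W p ℓ → ∀ v : HeightOneSpectrum (𝓞 K), (ℓ : 𝓞 K) ∈ v.asIdeal →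
      ∀ (e : ℤ), (e = 1 ∨ e = -1) →
      ∀ (x y : galoisCohomology ((W.baseChange K).torsionGaloisModule ((p ^ k : ℕ) : ℤ)) 1),
      conjAct W τ ((p ^ k : ℕ) : ℤ) x = e • x → conjAct W τ ((p ^ k : ℕ) : ℤ) y = e • y →
      galoisCohomology.localization ((W.baseChange K).torsionGaloisModule ((p ^ k : ℕ) : ℤ)) (Sum.inr v) 1 x ∈
        𝒯 (Sum.inr v) →
      galoisCohomology.localization ((W.baseChange K).torsionGaloisModule ((p ^ k : ℕ) : ℤ)) (Sum.inr v) 1 y ∈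
        (W.baseChange K).kummerSelmerStructure ((p ^ k : ℕ) : ℤ) (Sum.inr v) →
      galoisCohomology.localization ((W.baseChange K).torsionGaloisModule ((p ^ k : ℕ) : ℤ)) (Sum.inr v) 1 x ≠ 0 →
      galoisCohomology.localization ((W.baseChange K).torsionGaloisModule ((p ^ k : ℕ) : ℤ)) (Sum.inr v) 1 y ≠ 0 →
      pair v (galoisCohomology.localization ((W.baseChange K).torsionGaloisModule ((p ^ k : ℕ) : ℤ)) (Sum.inr v) 1 x)
        (galoisCohomology.localization ((W.baseChange K).torsionGaloisModule ((p ^ k : ℕ) : ℤ)) (Sum.inr v) 1 y) ≠ 0)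
    (hrec : ∀ (s : {m : ℕ // Squarefree m ∧ ∀ q ∈ m.primeFactors,
        Zhang2014.IsKolyvaginPrime (W.conductorNorm ℤ) W K p q ∧ i₀ ≤ Zhang2014.kolyvaginIndex W p q})
      (ℓ₀ ℓ : ℕ), Zhang2014.IsKolyvaginPrime (W.conductorNorm ℤ) W K p ℓ₀ → i₀ ≤ Zhang2014.kolyvaginIndex W p ℓ₀ →
      Zhang2014.IsKolyvaginPrime (W.conductorNorm ℤ) W K p ℓ → i₀ ≤ Zhang2014.kolyvaginIndex W p ℓ →
      ¬ ℓ₀ ∣ s.1 → ¬ ℓ ∣ s.1 → ℓ ≠ ℓ₀ →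
      ∀ v₀ : HeightOneSpectrum (𝓞 K), (ℓ₀ : 𝓞 K) ∈ v₀.asIdeal →
      ∀ v : HeightOneSpectrum (𝓞 K), (ℓ : 𝓞 K) ∈ v.asIdeal → ∀ (b : Bool)
      (a c : galoisCohomology ((W.baseChange K).torsionGaloisModule ((p ^ k : ℕ) : ℤ)) 1),
      a ∈ signPart W K τ ((p ^ k : ℕ) : ℤ) (if b then 1 else -1)
        ((selmerF W ((p ^ k : ℕ) : ℤ) 𝒯 (placesDividing K s.1)).relaxedAt {v₀}).selmerGroup →
      c ∈ signPart W K τ ((p ^ k : ℕ) : ℤ) (if b then 1 else -1)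
        (selmerF W ((p ^ k : ℕ) : ℤ) 𝒯 (placesDividing K (s.1 * ℓ₀ * ℓ))).selmerGroup →
      pair v₀ (galoisCohomology.localization ((W.baseChange K).torsionGaloisModule ((p ^ k : ℕ) : ℤ))
          (Sum.inr v₀) 1 c)
        (galoisCohomology.localization ((W.baseChange K).torsionGaloisModule ((p ^ k : ℕ) : ℤ))
          (Sum.inr v₀) 1 a) +
      pair v (galoisCohomology.localization ((W.baseChange K).torsionGaloisModule ((p ^ k : ℕ) : ℤ))
          (Sum.inr v) 1 c)
        (galoisCohomology.localization ((W.baseChange K).torsionGaloisModule ((p ^ k : ℕ) : ℤ))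
          (Sum.inr v) 1 a) = 0)
    -- the level-`p` classes `κ̄_n` and their dictionary
    (κb : {m : ℕ // Squarefree m ∧ ∀ q ∈ m.primeFactors,
        Zhang2014.IsKolyvaginPrime (W.conductorNorm ℤ) W K p q ∧ i₀ ≤ Zhang2014.kolyvaginIndex W p q} →
      galoisCohomology ((W.baseChange K).torsionGaloisModule ((p ^ k : ℕ) : ℤ)) 1)
    (hκSel : ∀ s, κb s ∈ signPart W K τ ((p ^ k : ℕ) : ℤ) (if eb s.1 then 1 else -1)
      (selmerF W ((p ^ k : ℕ) : ℤ) 𝒯 (placesDividing K s.1)).selmerGroup)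
    (h44c : ∀ (s s' : {m : ℕ // Squarefree m ∧ ∀ q ∈ m.primeFactors,
        Zhang2014.IsKolyvaginPrime (W.conductorNorm ℤ) W K p q ∧ i₀ ≤ Zhang2014.kolyvaginIndex W p q}) (ℓ : ℕ),
      ¬ ℓ ∣ s.1 → s'.1 = s.1 * ℓ → ∀ v : HeightOneSpectrum (𝓞 K), (ℓ : 𝓞 K) ∈ v.asIdeal →
      (galoisCohomology.localization ((W.baseChange K).torsionGaloisModule ((p ^ k : ℕ) : ℤ)) (Sum.inr v) 1
          (κb s') = 0 ↔
        galoisCohomology.localization ((W.baseChange K).torsionGaloisModule ((p ^ k : ℕ) : ℤ)) (Sum.inr v) 1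
          (κb s) = 0))
    (hκ0 : ∀ s, κb s ≠ 0 ↔ ¬ PDiv (D s) p i₀)
    -- the start
    (c : ℕ) (hc : Squarefree c ∧ ∀ q ∈ c.primeFactors,
      Zhang2014.IsKolyvaginPrime (W.conductorNorm ℤ) W K p q ∧ i₀ ≤ Zhang2014.kolyvaginIndex W p q)
    (hc0 : ¬ PDiv (D ⟨c, hc⟩) p i₀) :
    ∃ s : {m : ℕ // Squarefree m ∧ ∀ q ∈ m.primeFactors,
        Zhang2014.IsKolyvaginPrime (W.conductorNorm ℤ) W K p q ∧ i₀ ≤ Zhang2014.kolyvaginIndex W p q},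
      (∀ q ∈ s.1.primeFactors, e₀ ≤ Zhang2014.kolyvaginIndex W p q) ∧ ¬ PDiv (D s) p i₀ :=
  exists_deep_of_swapFamilies W K p Dt β ι τ k i₀ e₀ hk 𝒯 D eb heb
    (fun j _ he x y hx hy hy0 b ↦
      exists_kolyvaginPrime_addOrderOf_localization_eq_shift_of_irr_of_neg W hK hp2 hirr hneg hq hqd hqN hqp τ hτ
        hk j he x y hx hy hy0 b)
    hPT pair hperf hrec κb hκSel h44c hκ0 c hc hc0

/-- **The prime swap on the (T4″)@3 CORNER row objects (`p = 3`, `E[3]` irreducible, `ρ̄_{E,3}` not onto — item 19111,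
Upper kit `stub_upper3_jetchevMax`)** — the `−1`-input is FREE at `3`: every irreducible subgroup of `GL₂(𝔽₃)` contains
`−1`, indeed a square root of it in the image (shim3b g3's `ShimuraKolyvaginMinusOneSquare.exists_sq_smul_eq_neg_three_of_irr`),
so only Gross's disjointness prime `q ∣ d_K`, `q ∤ N_E`, `q ≠ 3` remains beside `hPT`, the pairing package and the `κ̄`
dictionary. [cite: McCallumLMS1991, §5 Prop. 5.2 (p. 304), §3 Cor. 3.2 (p. 299)] [cite: BurungaleEtAl2026, Prop. 2.2.1 (§2.2)]
[cite: Serre1972, §2.5 (the subgroups of GL₂(𝔽₃))] -/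
theorem exists_deep_of_swapFamilies_of_irr_three
    (W : WeierstrassCurve ℚ) [W.IsElliptic] [W.IsGloballyMinimal] [NeZero (W.conductorNorm ℤ)]
    (K : Type) [Field K] [NumberField K] (p : ℕ) [Fact p.Prime]
    (Dt : ModularParametrizationData W (W.conductorNorm ℤ)) (β : ℤ) (ι : K →+* ℂ)
    (hp3 : p = 3) (hK : IsImaginaryQuadratic K) (hirr : W.HasIrreducibleModPGaloisRep p)
    {q : ℕ} (hq : q.Prime) (hqd : (q : ℤ) ∣ NumberField.discr K) (hqN : ¬ q ∣ W.conductorNorm ℤ) (hqp : q ≠ p)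
    (τ : K ≃ₐ[ℚ] K) (hτ : τ ≠ 1) (k i₀ e₀ : ℕ) (hk : 1 ≤ k)
    (𝒯 : SelmerStructure ((W.baseChange K).torsionGaloisModule ((p ^ k : ℕ) : ℤ)))
    (D : ∀ s : {m : ℕ // Squarefree m ∧ ∀ q ∈ m.primeFactors,
        Zhang2014.IsKolyvaginPrime (W.conductorNorm ℤ) W K p q ∧ i₀ ≤ Zhang2014.kolyvaginIndex W p q},
      KolyvaginHeegnerData Dt β ι s.1)
    (eb : ℕ → Bool) (heb : ∀ (m ℓ : ℕ), ℓ.Prime → ¬ ℓ ∣ m → eb (m * ℓ) = !eb m)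
    -- global duality count at a relaxed prime, per sign (the walk's `hPT`)
    (hPT : ∀ (s : {m : ℕ // Squarefree m ∧ ∀ q ∈ m.primeFactors,
        Zhang2014.IsKolyvaginPrime (W.conductorNorm ℤ) W K p q ∧ i₀ ≤ Zhang2014.kolyvaginIndex W p q})
      (ℓ : ℕ), Zhang2014.IsKolyvaginPrime (W.conductorNorm ℤ) W K p ℓ →
      i₀ ≤ Zhang2014.kolyvaginIndex W p ℓ → ¬ ℓ ∣ s.1 →
      ∀ v : HeightOneSpectrum (𝓞 K), (ℓ : 𝓞 K) ∈ v.asIdeal → ∀ b : Bool,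
      Nat.card ((signPart W K τ ((p ^ k : ℕ) : ℤ) (if b then 1 else -1)
          ((selmerF W ((p ^ k : ℕ) : ℤ) 𝒯 (placesDividing K s.1)).relaxedAt {v}).selmerGroup).map
        (galoisCohomology.localization ((W.baseChange K).torsionGaloisModule ((p ^ k : ℕ) : ℤ))
          (Sum.inr v) 1)) = p ^ k)
    -- the level-`p` local Tate pairing package
    {Z : Type} [AddCommGroup Z]
    (pair : ∀ v : HeightOneSpectrum (𝓞 K),
      galoisCohomology (((W.baseChange K).torsionGaloisModule ((p ^ k : ℕ) : ℤ)).toLocal (Sum.inr v)) 1 →+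
      galoisCohomology (((W.baseChange K).torsionGaloisModule ((p ^ k : ℕ) : ℤ)).toLocal (Sum.inr v)) 1 →+ Z)
    (hperf : ∀ (ℓ : ℕ), Zhang2014.IsKolyvaginPrime (W.conductorNorm ℤ) W K p ℓ →
      i₀ ≤ Zhang2014.kolyvaginIndex W p ℓ → ∀ v : HeightOneSpectrum (𝓞 K), (ℓ : 𝓞 K) ∈ v.asIdeal →
      ∀ (e : ℤ), (e = 1 ∨ e = -1) →
      ∀ (x y : galoisCohomology ((W.baseChange K).torsionGaloisModule ((p ^ k : ℕ) : ℤ)) 1),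
      conjAct W τ ((p ^ k : ℕ) : ℤ) x = e • x → conjAct W τ ((p ^ k : ℕ) : ℤ) y = e • y →
      galoisCohomology.localization ((W.baseChange K).torsionGaloisModule ((p ^ k : ℕ) : ℤ)) (Sum.inr v) 1 x ∈
        𝒯 (Sum.inr v) →
      galoisCohomology.localization ((W.baseChange K).torsionGaloisModule ((p ^ k : ℕ) : ℤ)) (Sum.inr v) 1 y ∈
        (W.baseChange K).kummerSelmerStructure ((p ^ k : ℕ) : ℤ) (Sum.inr v) →
      galoisCohomology.localization ((W.baseChange K).torsionGaloisModule ((p ^ k : ℕ) : ℤ)) (Sum.inr v) 1 x ≠ 0 →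
      galoisCohomology.localization ((W.baseChange K).torsionGaloisModule ((p ^ k : ℕ) : ℤ)) (Sum.inr v) 1 y ≠ 0 →
      pair v (galoisCohomology.localization ((W.baseChange K).torsionGaloisModule ((p ^ k : ℕ) : ℤ)) (Sum.inr v) 1 x)
        (galoisCohomology.localization ((W.baseChange K).torsionGaloisModule ((p ^ k : ℕ) : ℤ)) (Sum.inr v) 1 y) ≠ 0)
    (hrec : ∀ (s : {m : ℕ // Squarefree m ∧ ∀ q ∈ m.primeFactors,
        Zhang2014.IsKolyvaginPrime (W.conductorNorm ℤ) W K p q ∧ i₀ ≤ Zhang2014.kolyvaginIndex W p q})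
      (ℓ₀ ℓ : ℕ), Zhang2014.IsKolyvaginPrime (W.conductorNorm ℤ) W K p ℓ₀ → i₀ ≤ Zhang2014.kolyvaginIndex W p ℓ₀ →
      Zhang2014.IsKolyvaginPrime (W.conductorNorm ℤ) W K p ℓ → i₀ ≤ Zhang2014.kolyvaginIndex W p ℓ →
      ¬ ℓ₀ ∣ s.1 → ¬ ℓ ∣ s.1 → ℓ ≠ ℓ₀ →
      ∀ v₀ : HeightOneSpectrum (𝓞 K), (ℓ₀ : 𝓞 K) ∈ v₀.asIdeal →
      ∀ v : HeightOneSpectrum (𝓞 K), (ℓ : 𝓞 K) ∈ v.asIdeal → ∀ (b : Bool)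
      (a c : galoisCohomology ((W.baseChange K).torsionGaloisModule ((p ^ k : ℕ) : ℤ)) 1),
      a ∈ signPart W K τ ((p ^ k : ℕ) : ℤ) (if b then 1 else -1)
        ((selmerF W ((p ^ k : ℕ) : ℤ) 𝒯 (placesDividing K s.1)).relaxedAt {v₀}).selmerGroup →
      c ∈ signPart W K τ ((p ^ k : ℕ) : ℤ) (if b then 1 else -1)
        (selmerF W ((p ^ k : ℕ) : ℤ) 𝒯 (placesDividing K (s.1 * ℓ₀ * ℓ))).selmerGroup →
      pair v₀ (galoisCohomology.localization ((W.baseChange K).torsionGaloisModule ((p ^ k : ℕ) : ℤ))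
          (Sum.inr v₀) 1 c)
        (galoisCohomology.localization ((W.baseChange K).torsionGaloisModule ((p ^ k : ℕ) : ℤ))
          (Sum.inr v₀) 1 a) +
      pair v (galoisCohomology.localization ((W.baseChange K).torsionGaloisModule ((p ^ k : ℕ) : ℤ))
          (Sum.inr v) 1 c)
        (galoisCohomology.localization ((W.baseChange K).torsionGaloisModule ((p ^ k : ℕ) : ℤ))
          (Sum.inr v) 1 a) = 0)
    -- the level-`p` classes `κ̄_n` and their dictionary
    (κb : {m : ℕ // Squarefree m ∧ ∀ q ∈ m.primeFactors,
        Zhang2014.IsKolyvaginPrime (W.conductorNorm ℤ) W K p q ∧ i₀ ≤ Zhang2014.kolyvaginIndex W p q} →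
      galoisCohomology ((W.baseChange K).torsionGaloisModule ((p ^ k : ℕ) : ℤ)) 1)
    (hκSel : ∀ s, κb s ∈ signPart W K τ ((p ^ k : ℕ) : ℤ) (if eb s.1 then 1 else -1)
      (selmerF W ((p ^ k : ℕ) : ℤ) 𝒯 (placesDividing K s.1)).selmerGroup)
    (h44c : ∀ (s s' : {m : ℕ // Squarefree m ∧ ∀ q ∈ m.primeFactors,
        Zhang2014.IsKolyvaginPrime (W.conductorNorm ℤ) W K p q ∧ i₀ ≤ Zhang2014.kolyvaginIndex W p q}) (ℓ : ℕ),
      ¬ ℓ ∣ s.1 → s'.1 = s.1 * ℓ → ∀ v : HeightOneSpectrum (𝓞 K), (ℓ : 𝓞 K) ∈ v.asIdeal →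
      (galoisCohomology.localization ((W.baseChange K).torsionGaloisModule ((p ^ k : ℕ) : ℤ)) (Sum.inr v) 1
          (κb s') = 0 ↔
        galoisCohomology.localization ((W.baseChange K).torsionGaloisModule ((p ^ k : ℕ) : ℤ)) (Sum.inr v) 1
          (κb s) = 0))
    (hκ0 : ∀ s, κb s ≠ 0 ↔ ¬ PDiv (D s) p i₀)
    -- the start
    (c : ℕ) (hc : Squarefree c ∧ ∀ q ∈ c.primeFactors,
      Zhang2014.IsKolyvaginPrime (W.conductorNorm ℤ) W K p q ∧ i₀ ≤ Zhang2014.kolyvaginIndex W p q)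
    (hc0 : ¬ PDiv (D ⟨c, hc⟩) p i₀) :
    ∃ s : {m : ℕ // Squarefree m ∧ ∀ q ∈ m.primeFactors,
        Zhang2014.IsKolyvaginPrime (W.conductorNorm ℤ) W K p q ∧ i₀ ≤ Zhang2014.kolyvaginIndex W p q},
      (∀ q ∈ s.1.primeFactors, e₀ ≤ Zhang2014.kolyvaginIndex W p q) ∧ ¬ PDiv (D s) p i₀ := by
  subst hp3
  obtain ⟨γ, hγ⟩ := ShimuraKolyvaginMinusOneSquare.exists_sq_smul_eq_neg_three_of_irr W hirr
  exact exists_deep_of_swapFamilies_of_irr_of_neg W K 3 Dt β ι hK (by decide) hirr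
    ⟨γ * γ, fun P ↦ by rw [mul_smul]; exact hγ P⟩ hq hqd hqN hqp τ hτ k i₀ e₀ hk 𝒯 D eb heb
    hPT pair hperf hrec κb hκSel h44c hκ0 c hc hc0

/-- **The prime swap on the row objects, `ρ̄_{E,p}` ONTO** (tam3-p1's J₃ frames at `p = 3`; 19109) —
`exists_deep_of_swapFamilies` with its Čebotarev input DISCHARGED by tam3-p1's
`exists_kolyvaginPrime_addOrderOf_localization_eq_shift` (p494064). Remaining inputs: `hPT`, the pairing package, the
`κ̄` dictionary. [cite: McCallumLMS1991, §5 Prop. 5.2 (p. 304), §3 Cor. 3.2 (p. 299)] [cite: BurungaleEtAl2026, Prop. 2.2.1 (§2.2)] -/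
theorem exists_deep_of_swapFamilies_of_surj
    (W : WeierstrassCurve ℚ) [W.IsElliptic] [W.IsGloballyMinimal] [NeZero (W.conductorNorm ℤ)]
    (K : Type) [Field K] [NumberField K] (p : ℕ) [Fact p.Prime]
    (Dt : ModularParametrizationData W (W.conductorNorm ℤ)) (β : ℤ) (ι : K →+* ℂ)
    (hK : IsImaginaryQuadratic K) (hp2 : p ≠ 2) (hρ : W.HasSurjectiveModNGaloisRep p)
    (τ : K ≃ₐ[ℚ] K) (hτ : τ ≠ 1) (k i₀ e₀ : ℕ) (hk : 1 ≤ k)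
    (𝒯 : SelmerStructure ((W.baseChange K).torsionGaloisModule ((p ^ k : ℕ) : ℤ)))
    (D : ∀ s : {m : ℕ // Squarefree m ∧ ∀ q ∈ m.primeFactors,
        Zhang2014.IsKolyvaginPrime (W.conductorNorm ℤ) W K p q ∧ i₀ ≤ Zhang2014.kolyvaginIndex W p q},
      KolyvaginHeegnerData Dt β ι s.1)
    (eb : ℕ → Bool) (heb : ∀ (m ℓ : ℕ), ℓ.Prime → ¬ ℓ ∣ m → eb (m * ℓ) = !eb m)
    -- global duality count at a relaxed prime, per sign (the walk's `hPT`)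
    (hPT : ∀ (s : {m : ℕ // Squarefree m ∧ ∀ q ∈ m.primeFactors,
        Zhang2014.IsKolyvaginPrime (W.conductorNorm ℤ) W K p q ∧ i₀ ≤ Zhang2014.kolyvaginIndex W p q})
      (ℓ : ℕ), Zhang2014.IsKolyvaginPrime (W.conductorNorm ℤ) W K p ℓ →
      i₀ ≤ Zhang2014.kolyvaginIndex W p ℓ → ¬ ℓ ∣ s.1 →
      ∀ v : HeightOneSpectrum (𝓞 K), (ℓ : 𝓞 K) ∈ v.asIdeal → ∀ b : Bool,
      Nat.card ((signPart W K τ ((p ^ k : ℕ) : ℤ) (if b then 1 else -1)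
          ((selmerF W ((p ^ k : ℕ) : ℤ) 𝒯 (placesDividing K s.1)).relaxedAt {v}).selmerGroup).map
        (galoisCohomology.localization ((W.baseChange K).torsionGaloisModule ((p ^ k : ℕ) : ℤ))
          (Sum.inr v) 1)) = p ^ k)
    -- the level-`p` local Tate pairing package
    {Z : Type} [AddCommGroup Z]
    (pair : ∀ v : HeightOneSpectrum (𝓞 K),
      galoisCohomology (((W.baseChange K).torsionGaloisModule ((p ^ k : ℕ) : ℤ)).toLocal (Sum.inr v)) 1 →+
      galoisCohomology (((W.baseChange K).torsionGaloisModule ((p ^ k : ℕ) : ℤ)).toLocal (Sum.inr v)) 1 →+ Z)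
    (hperf : ∀ (ℓ : ℕ), Zhang2014.IsKolyvaginPrime (W.conductorNorm ℤ) W K p ℓ →
      i₀ ≤ Zhang2014.kolyvaginIndex W p ℓ → ∀ v : HeightOneSpectrum (𝓞 K), (ℓ : 𝓞 K) ∈ v.asIdeal →
      ∀ (e : ℤ), (e = 1 ∨ e = -1) →
      ∀ (x y : galoisCohomology ((W.baseChange K).torsionGaloisModule ((p ^ k : ℕ) : ℤ)) 1),
      conjAct W τ ((p ^ k : ℕ) : ℤ) x = e • x → conjAct W τ ((p ^ k : ℕ) : ℤ) y = e • y →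
      galoisCohomology.localization ((W.baseChange K).torsionGaloisModule ((p ^ k : ℕ) : ℤ)) (Sum.inr v) 1 x ∈
        𝒯 (Sum.inr v) →
      galoisCohomology.localization ((W.baseChange K).torsionGaloisModule ((p ^ k : ℕ) : ℤ)) (Sum.inr v) 1 y ∈
        (W.baseChange K).kummerSelmerStructure ((p ^ k : ℕ) : ℤ) (Sum.inr v) →
      galoisCohomology.localization ((W.baseChange K).torsionGaloisModule ((p ^ k : ℕ) : ℤ)) (Sum.inr v) 1 x ≠ 0 →
      galoisCohomology.localization ((W.baseChange K).torsionGaloisModule ((p ^ k : ℕ) : ℤ)) (Sum.inr v) 1 y ≠ 0 →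
      pair v (galoisCohomology.localization ((W.baseChange K).torsionGaloisModule ((p ^ k : ℕ) : ℤ)) (Sum.inr v) 1 x)
        (galoisCohomology.localization ((W.baseChange K).torsionGaloisModule ((p ^ k : ℕ) : ℤ)) (Sum.inr v) 1 y) ≠ 0)
    (hrec : ∀ (s : {m : ℕ // Squarefree m ∧ ∀ q ∈ m.primeFactors,
        Zhang2014.IsKolyvaginPrime (W.conductorNorm ℤ) W K p q ∧ i₀ ≤ Zhang2014.kolyvaginIndex W p q})
      (ℓ₀ ℓ : ℕ), Zhang2014.IsKolyvaginPrime (W.conductorNorm ℤ) W K p ℓ₀ → i₀ ≤ Zhang2014.kolyvaginIndex W p ℓ₀ →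
      Zhang2014.IsKolyvaginPrime (W.conductorNorm ℤ) W K p ℓ → i₀ ≤ Zhang2014.kolyvaginIndex W p ℓ →
      ¬ ℓ₀ ∣ s.1 → ¬ ℓ ∣ s.1 → ℓ ≠ ℓ₀ →
      ∀ v₀ : HeightOneSpectrum (𝓞 K), (ℓ₀ : 𝓞 K) ∈ v₀.asIdeal →
      ∀ v : HeightOneSpectrum (𝓞 K), (ℓ : 𝓞 K) ∈ v.asIdeal → ∀ (b : Bool)
      (a c : galoisCohomology ((W.baseChange K).torsionGaloisModule ((p ^ k : ℕ) : ℤ)) 1),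
      a ∈ signPart W K τ ((p ^ k : ℕ) : ℤ) (if b then 1 else -1)
        ((selmerF W ((p ^ k : ℕ) : ℤ) 𝒯 (placesDividing K s.1)).relaxedAt {v₀}).selmerGroup →
      c ∈ signPart W K τ ((p ^ k : ℕ) : ℤ) (if b then 1 else -1)
        (selmerF W ((p ^ k : ℕ) : ℤ) 𝒯 (placesDividing K (s.1 * ℓ₀ * ℓ))).selmerGroup →
      pair v₀ (galoisCohomology.localization ((W.baseChange K).torsionGaloisModule ((p ^ k : ℕ) : ℤ))
          (Sum.inr v₀) 1 c)
        (galoisCohomology.localization ((W.baseChange K).torsionGaloisModule ((p ^ k : ℕ) : ℤ))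
          (Sum.inr v₀) 1 a) +
      pair v (galoisCohomology.localization ((W.baseChange K).torsionGaloisModule ((p ^ k : ℕ) : ℤ))
          (Sum.inr v) 1 c)
        (galoisCohomology.localization ((W.baseChange K).torsionGaloisModule ((p ^ k : ℕ) : ℤ))
          (Sum.inr v) 1 a) = 0)
    -- the level-`p` classes `κ̄_n` and their dictionary
    (κb : {m : ℕ // Squarefree m ∧ ∀ q ∈ m.primeFactors,
        Zhang2014.IsKolyvaginPrime (W.conductorNorm ℤ) W K p q ∧ i₀ ≤ Zhang2014.kolyvaginIndex W p q} →
      galoisCohomology ((W.baseChange K).torsionGaloisModule ((p ^ k : ℕ) : ℤ)) 1)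
    (hκSel : ∀ s, κb s ∈ signPart W K τ ((p ^ k : ℕ) : ℤ) (if eb s.1 then 1 else -1)
      (selmerF W ((p ^ k : ℕ) : ℤ) 𝒯 (placesDividing K s.1)).selmerGroup)
    (h44c : ∀ (s s' : {m : ℕ // Squarefree m ∧ ∀ q ∈ m.primeFactors,
        Zhang2014.IsKolyvaginPrime (W.conductorNorm ℤ) W K p q ∧ i₀ ≤ Zhang2014.kolyvaginIndex W p q}) (ℓ : ℕ),
      ¬ ℓ ∣ s.1 → s'.1 = s.1 * ℓ → ∀ v : HeightOneSpectrum (𝓞 K), (ℓ : 𝓞 K) ∈ v.asIdeal →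
      (galoisCohomology.localization ((W.baseChange K).torsionGaloisModule ((p ^ k : ℕ) : ℤ)) (Sum.inr v) 1
          (κb s') = 0 ↔
        galoisCohomology.localization ((W.baseChange K).torsionGaloisModule ((p ^ k : ℕ) : ℤ)) (Sum.inr v) 1
          (κb s) = 0))
    (hκ0 : ∀ s, κb s ≠ 0 ↔ ¬ PDiv (D s) p i₀)
    -- the start
    (c : ℕ) (hc : Squarefree c ∧ ∀ q ∈ c.primeFactors,
      Zhang2014.IsKolyvaginPrime (W.conductorNorm ℤ) W K p q ∧ i₀ ≤ Zhang2014.kolyvaginIndex W p q)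
    (hc0 : ¬ PDiv (D ⟨c, hc⟩) p i₀) :
    ∃ s : {m : ℕ // Squarefree m ∧ ∀ q ∈ m.primeFactors,
        Zhang2014.IsKolyvaginPrime (W.conductorNorm ℤ) W K p q ∧ i₀ ≤ Zhang2014.kolyvaginIndex W p q},
      (∀ q ∈ s.1.primeFactors, e₀ ≤ Zhang2014.kolyvaginIndex W p q) ∧ ¬ PDiv (D s) p i₀ :=
  exists_deep_of_swapFamilies W K p Dt β ι τ k i₀ e₀ hk 𝒯 D eb heb
    (fun j _ he x y hx hy hy0 b ↦
      exists_kolyvaginPrime_addOrderOf_localization_eq_shift W hK hp2 hρ τ hτ hk j he x y hx hy hy0 b)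
    hPT pair hperf hrec κb hκSel h44c hκ0 c hc hc0


end Summit.BirchSwinnertonDyer.Rank1Residual.X11b.Three.Koly

end
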